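import Summits.BirchSwinnertonDyer.BirchSwinnertonDyer.Theorems.AlignedTransportAtTwoMainConjectureOfRankZeroBSDAtTwoCubicChevalleyLValueBit
import Summits.BirchSwinnertonDyer.BirchSwinnertonDyer.Theorems.AlignedTransportAtTwoMainConjectureOfRankZeroBSDAtTwoCubicKilfordPrimes
import Summits.BirchSwinnertonDyer.BirchSwinnertonDyer.Theorems.AlignedTransportAtTwoOffStratumPartitionTwistFamilySmallSeeds
import Summits.BirchSwinnertonDyer.Rank1Residual.Additive.IntModelTamagawaCertificate
import Literature.NumberTheory.EllipticCurves.ComplexMultiplicationTwistIsogenyProofs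
import Literature.NumberTheory.EllipticCurves.ComplexMultiplicationRationalJIntegralProofs
import HarnessLib

/-!
# Route `AlignedTransportAtTwo`, crux C2 `MainConjectureOfRankZeroBSDAtTwo` (stmt-BirchSwinnertonDyer-22298):
# ODD-BRANCH ROWS II — `MC₂` for `[1, -1, 0, -11, -12]` (conductor `4771 = 13·367`) from PRINT + ONE `L`-VALUE BIT

HONEST FRAMING (cell `bsd-f1-sign2`, WIDTH-5 attached prover seat `bsd-line-att-p5` gen 32 on line `birth` of the lead `bsd-line-att-p2`;
`--supports` stmt-BirchSwinnertonDyer-22298, closes nothing; BSD is NOT proved by any of this; the crux C2, its verdict «blocked-on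
`Rank1Residual.GreenbergMuConjectureIrreducible`» and every registered stub are untouched). THEOREMS ONLY; the curve is written LITERALLY,
exactly as in the sister files `…CubicChevalleyRow307b1` / `…Row139a1` / `…RowN1763` (att-p5 g31). No Cremona label is asserted for this curve
(the seat holds Cremona's 1992 table only up to `N = 1000`); names use the suffix `n4771`.

THE SEED. `W = [1, -1, 0, -11, -12]`: `Δ_min = -4771 = −13·367 ≡ 5 (mod 8)` (off the Kilford stratum), `c₄ = 537`,
`a₂ = +1` (good ORDINARY, `#Ẽ(𝔽₂) = 2`), `E[2]` irreducible (`u³ − 3u² − 176u − 768` has no root mod `5`), bad primes: `13` (`⌊√13⌋ = 3`) NON-SPLIT of type `I₁` (the node-tangent quadratic has no root mod `13`, by exhaustion); `367` (`⌊√367⌋ = 19`) SPLIT of type `I₁` (node-tangent root `w = 144`);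
all `c_p = 1`, torsion trivial; on the seat (pure Python, g31's `lval.py`, census `unram_census.tsv` ca3b9fb012961b71): `w = +1`,
`L(1) = Ω = 1.3028627973`, so `r_an = 0` and `L/Ω = 1` — a member of the g31 firing census `{Δ_min ≡ 5 (8)} ∩ {odd L/Ω} ∩ {σ₁(η) ≡ 3 (8)}`
(crux workfile `ODD-BRANCH-att-p5-g31.md` §7/§8). Unit of `ℚ(β)`: `η = (29464 + 1199u - 181u²)/8`, `u = 4β`, `η³ − 3331η² + 2989899η − 1 = 0`;
odd `2`-adic root `e ≡ 19 (mod 64)`, `P(19) = -13096 ≡ 2^3·3 (mod 2^6)` ⟹ `σ₁(η) ≡ 3 (mod 8)`, sign `−1`: the door FIRES.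
All constants were emitted by the lineage's `rowkit.py` (HOME `ODDBRANCH-att-p5-g31-data/`).

WHAT. §1 kernel-decided curve data (incl. the Tate row certificate and `N = 4771` from `Squarefree 4771`); §2 `BSD₂` from Creutz–Miller;
§3 the unit certificate; §4 ★ `mazurMainConjecture_two_n4771_of_lValue` (+ `_eq_one`), `classicalMuVanishes_cubicField_n4771_of_lValue`.
CONDITIONAL theorems; nothing is closed; BSD is not proved; beyond-print theorem: no.

References: [CreutzMiller2012] Thm. 1.1; [YooYu2022] Thm. 1.6 with 1.4 / 1.10 / 1.11 (1), Lemma 4.11; [Kato2004Asterisque] Thm. 17.4; [GreenbergLNM1716] Thm. 4.1;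
[Miller2011LMS] Def. 1.1; [SilvermanAEC2009] III.1, VII.1, VII.5; [Silverman1994] IV.9.4, IV.10.2; [Serre1973] II §3.3; [Cohen1993] Alg. 7.4.8 (AGM period);
tree: att-p5 g29 `…CubicChevalleyUnitSign(Doors)`, g30 `…CubicChevalleyLValueBit`, g31 `…CubicChevalleyRow307b1` / `…Row139a1` / `…RowN1763`, b2b `Rank2ObservatoryTamagawa*`.
-/

set_option linter.dupNamespace false
set_option autoImplicit false

noncomputable section

open scoped Classical NumberField nonZeroDivisors IntermediateField

namespace Summit.BirchSwinnertonDyer.BirchSwinnertonDyer.Theorems.AlignedTransportAtTwoCubicChevalleyRowN4771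

open NumberField IsDedekindDomain Polynomial WeierstrassCurve IntermediateField CongruenceSubgroup
  Literature.NumberTheory.IwasawaTheory Literature.NumberTheory.GaloisRepresentations
  Literature.NumberTheory.EllipticCurves Literature.NumberTheory.EllipticCurves.Greenberg1999
  Literature.NumberTheory.EllipticCurves.ModularForms Literature.NumberTheory.EllipticCurves.Rank1Residual
  Literature.NumberTheory.EllipticCurves.Module Literature.NumberTheory.EllipticCurves.Zhai2016
  Summit.BirchSwinnertonDyer.Rank1Residual Summit.BirchSwinnertonDyer.Rank1Residual.X1.MuLambda
  Summit.BirchSwinnertonDyer.Rank1Residual.X5 Summit.BirchSwinnertonDyer.Rank1Residual.X5.O1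
  Summit.BirchSwinnertonDyer.Rank1Residual.X5.Instances Summit.BirchSwinnertonDyer.Rank1Residual.F1Sign2
  Summit.BirchSwinnertonDyer.BirchSwinnertonDyer.Theorems.Rank1ResidualX1Defs
  Summit.BirchSwinnertonDyer.BirchSwinnertonDyer.Theses.AlignedTransportAtTwo
  Summit.BirchSwinnertonDyer.BirchSwinnertonDyer.Rank2Observatory.Tam
  Summit.BirchSwinnertonDyer.Rank1Residual.Additive.IntModelTam
  Summit.BirchSwinnertonDyer.BirchSwinnertonDyer.Theorems.AlignedTransportAtTwoCubicChevalleyLValueBit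
  Summit.BirchSwinnertonDyer.BirchSwinnertonDyer.Theorems.AlignedTransportAtTwoSelmerTwoOfBSDp
open Summit.BirchSwinnertonDyer.BirchSwinnertonDyer.Theorems.AlignedTransportAtTwoCubicKilfordPrimes (psi_gen_eq_zero)
open Summit.BirchSwinnertonDyer.BirchSwinnertonDyer.Theorems.AlignedTransportAtTwoKilfordStratumShared
  (not_onKilfordStratumAtTwo_iff_minimalDiscriminantInt_emod_eight_ne)

/-! ## §1 The curve `[1, -1, 0, -11, -12]` of conductor `4771` — kernel-decided invariants -/

/-- `Δ = -4771` = −13·367`. [cite: SilvermanAEC2009, III.1] -/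
theorem M4771_Δ : (⟨1, -1, 0, -11, -12⟩ : WeierstrassCurve ℤ).Δ = -4771 := by decide

/-- `c₄ = 537`. [cite: SilvermanAEC2009, III.1] -/
theorem M4771_c₄ : (⟨1, -1, 0, -11, -12⟩ : WeierstrassCurve ℤ).c₄ = 537 := by decide

/-- `[1, -1, 0, -11, -12]` is an elliptic curve (`Δ = -4771 ≠ 0`). [cite: SilvermanAEC2009, III.1] -/
theorem isElliptic_n4771 : ((⟨1, -1, 0, -11, -12⟩ : WeierstrassCurve ℤ).baseChange ℚ).IsElliptic := by
  rw [WeierstrassCurve.isElliptic_iff, baseChange_int_Δ, M4771_Δ]; norm_num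

/-- The model `[1, -1, 0, -11, -12]` is globally minimal (`gcd(Δ, c₄) = 1`). [cite: SilvermanAEC2009, VII.1 Remark 1.1] -/
theorem isGloballyMinimal_n4771 : ((⟨1, -1, 0, -11, -12⟩ : WeierstrassCurve ℤ).baseChange ℚ).IsGloballyMinimal :=
  isGloballyMinimal_baseChange_int_of_gcd_eq_one 1 (-1) 0 (-11) (-12) (by decide)

/-- `Δ` and `c₄` of `[1, -1, 0, -11, -12]` are coprime (semistable model). [cite: SilvermanAEC2009, VII.5 Prop. 5.1 (b)] -/
theorem M4771_coprime : IsCoprime (⟨1, -1, 0, -11, -12⟩ : WeierstrassCurve ℤ).Δ (⟨1, -1, 0, -11, -12⟩ : WeierstrassCurve ℤ).c₄ := by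
  rw [M4771_Δ, M4771_c₄, Int.isCoprime_iff_gcd_eq_one]; decide

/-- **`N = 4771 = 13·367`** (semistable: `N = rad Δ`, `Δ = -4771` squarefree). [cite: Silverman1994, IV.10.2 (a),(b)] -/
theorem conductorNorm_n4771 [((⟨1, -1, 0, -11, -12⟩ : WeierstrassCurve ℤ).baseChange ℚ).IsElliptic] :
    ((⟨1, -1, 0, -11, -12⟩ : WeierstrassCurve ℤ).baseChange ℚ).conductorNorm ℤ = 4771 := by
  refine conductorNorm_baseChange_int_of_isCoprime (⟨1, -1, 0, -11, -12⟩ : WeierstrassCurve ℤ) M4771_coprime (k := 1) ?_ ?_ ?_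
  · rw [show (4771 : ℕ) = 13 * 367 by norm_num]
    exact (Nat.squarefree_mul (by norm_num : Nat.Coprime 13 367)).mpr
      ⟨(show Nat.Prime 13 by norm_num).prime.squarefree, (show Nat.Prime 367 by norm_num).prime.squarefree⟩
  · rw [M4771_Δ]; norm_num
  · rw [M4771_Δ]; norm_num

/-- `[1, -1, 0, -11, -12] mod 2` is `[1, 1, 0, 1, 0]` over `𝔽₂`. [folklore] -/
theorem M4771_mod_two : (⟨1, -1, 0, -11, -12⟩ : WeierstrassCurve ℤ).map (Int.castRingHom (ZMod 2)) = ⟨1, 1, 0, 1, 0⟩ := by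
  ext <;> decide

/-- `#Ẽ(𝔽₂) = 2` for `[1, -1, 0, -11, -12]` (points `O`, `(0,0)`): `a₂ = 3 − 2 = +1`. [cite: SilvermanAEC2009, V.2] -/
theorem M4771_card_two :
    Nat.card ((⟨1, -1, 0, -11, -12⟩ : WeierstrassCurve ℤ).map (Int.castRingHom (ZMod 2))).toAffine.Point = 2 := by
  rw [M4771_mod_two, natCard_point_eq_one_add_card _ (by decide)]; decide

/-- **`[1, -1, 0, -11, -12]` has good ORDINARY reduction at `2`** (`2 ∤ Δ`, `#Ẽ(𝔽₂) = 2`). [cite: SilvermanAEC2009, VII.5 Prop. 5.1 (a)] -/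
theorem goodOrd_two_n4771 [((⟨1, -1, 0, -11, -12⟩ : WeierstrassCurve ℤ).baseChange ℚ).IsElliptic]
    [((⟨1, -1, 0, -11, -12⟩ : WeierstrassCurve ℤ).baseChange ℚ).IsGloballyMinimal] :
    GoodOrd ((⟨1, -1, 0, -11, -12⟩ : WeierstrassCurve ℤ).baseChange ℚ) 2 :=
  goodOrd_two_baseChange_int_of_card_two _ (by rw [M4771_Δ]; decide) M4771_card_two

/-- The coefficients of `[1, -1, 0, -11, -12] / ℚ` (unfolded). [cite: SilvermanAEC2009, III.1] -/
theorem c4771_eq : ((⟨1, -1, 0, -11, -12⟩ : WeierstrassCurve ℤ).baseChange ℚ) = ⟨1, -1, 0, -11, -12⟩ := by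
  rw [baseChange_int_eq]; norm_num

/-- `b₂, b₄, b₆` of `[1, -1, 0, -11, -12]`: `-3, -22, -48`. [cite: SilvermanAEC2009, III.1] -/
theorem c4771_b : ((⟨1, -1, 0, -11, -12⟩ : WeierstrassCurve ℤ).baseChange ℚ).b₂ = ((-3 : ℤ) : ℚ) ∧
    ((⟨1, -1, 0, -11, -12⟩ : WeierstrassCurve ℤ).baseChange ℚ).b₄ = ((-22 : ℤ) : ℚ) ∧
    ((⟨1, -1, 0, -11, -12⟩ : WeierstrassCurve ℤ).baseChange ℚ).b₆ = ((-48 : ℤ) : ℚ) := by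
  rw [c4771_eq]; simp only [WeierstrassCurve.b₂, WeierstrassCurve.b₄, WeierstrassCurve.b₆]; norm_num

/-- **`E[2]` irreducible for `[1, -1, 0, -11, -12]`**: the monic `u`-cubic `u³ − 3u² − 176u − 768` has no root modulo `5`.
[cite: SilvermanAEC2009, III.2.3 (b)] -/
theorem irr_two_n4771 [((⟨1, -1, 0, -11, -12⟩ : WeierstrassCurve ℤ).baseChange ℚ).IsElliptic] :
    Irr ((⟨1, -1, 0, -11, -12⟩ : WeierstrassCurve ℤ).baseChange ℚ) 2 :=
  irr_two_of_forall_cubic_ne _ c4771_b.1 c4771_b.2.1 c4771_b.2.2 (ℓ := 5) (by decide)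

/-- No rational `2`-torsion abscissa on `[1, -1, 0, -11, -12]` (the route's `ht` binder). [cite: SilvermanAEC2009, III.2.3 (b)] -/
theorem not_hasRationalTwoTorsionX_n4771 [((⟨1, -1, 0, -11, -12⟩ : WeierstrassCurve ℤ).baseChange ℚ).IsElliptic] :
    ∀ x : ℚ, ¬ HasRationalTwoTorsionX ((⟨1, -1, 0, -11, -12⟩ : WeierstrassCurve ℤ).baseChange ℚ) x := by
  intro x hx
  exact (O1.irr_two_iff_not_exists_addOrderOf_eq_two _).mp irr_two_n4771 (exists_point_addOrderOf_eq_two hx)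

/-- `Δ_min = -4771`. [cite: SilvermanAEC2009, VII.1] -/
theorem minimalDiscriminantInt_n4771 [((⟨1, -1, 0, -11, -12⟩ : WeierstrassCurve ℤ).baseChange ℚ).IsGloballyMinimal] :
    ((⟨1, -1, 0, -11, -12⟩ : WeierstrassCurve ℤ).baseChange ℚ).minimalDiscriminantInt = -4771 := by
  rw [Instances.minimalDiscriminantInt_baseChange_int, M4771_Δ]

/-- **`[1, -1, 0, -11, -12]` is OFF the Kilford stratum** (`Δ_min = -4771 ≡ 5 ≢ 1 (mod 8)`; good ordinary at `2`). [cite: Serre1973, Ch. II §3.3 Thm. 4] -/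
theorem not_onKilfordStratumAtTwo_n4771 [((⟨1, -1, 0, -11, -12⟩ : WeierstrassCurve ℤ).baseChange ℚ).IsElliptic]
    [((⟨1, -1, 0, -11, -12⟩ : WeierstrassCurve ℤ).baseChange ℚ).IsGloballyMinimal] :
    ¬ OnKilfordStratumAtTwo ((⟨1, -1, 0, -11, -12⟩ : WeierstrassCurve ℤ).baseChange ℚ) :=
  (not_onKilfordStratumAtTwo_iff_minimalDiscriminantInt_emod_eight_ne _ goodOrd_two_n4771).mpr
    (by rw [minimalDiscriminantInt_n4771]; decide)

/-- `Δ < 0` (one real root of the `2`-division cubic). [cite: SilvermanAEC2009, III.1] -/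
theorem Δ_n4771_neg : ((⟨1, -1, 0, -11, -12⟩ : WeierstrassCurve ℤ).baseChange ℚ).Δ < 0 := by
  rw [baseChange_int_Δ, M4771_Δ]; norm_num

/-- Tate's algorithm ROW CERTIFICATE of `[1, -1, 0, -11, -12]`: `13` (`⌊√13⌋ = 3`) NON-SPLIT of type `I₁` (the node-tangent quadratic has no root mod `13`, by exhaustion); `367` (`⌊√367⌋ = 19`) SPLIT of type `I₁` (node-tangent root `w = 144`); every `c_p = 1`.
[cite: Silverman1994, IV.9.4 Step 2] -/
theorem tamRowCheck_n4771 :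
    TamLocal.rowCheck [⟨13, 3, 2, 0, 0, 0, 0, 1, 0, 0, 1⟩, ⟨367, 19, 1, 144, 0, 0, 0, 1, 0, 0, 1⟩] (⟨1, -1, 0, -11, -12⟩ : WeierstrassCurve ℤ) = true := by
  decide +kernel

/-- **`2 ∤ ∏ c_ℓ`** (indeed `∏ c_ℓ = c_13 c_367 = 1`), from the row certificate. [cite: Silverman1994, IV.9.4 Step 2] -/
theorem not_two_dvd_tamagawaProduct_n4771 [((⟨1, -1, 0, -11, -12⟩ : WeierstrassCurve ℤ).baseChange ℚ).IsGloballyMinimal] :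
    ¬ 2 ∣ ((⟨1, -1, 0, -11, -12⟩ : WeierstrassCurve ℤ).baseChange ℚ).tamagawaProduct :=
  not_dvd_tamagawaProduct_of_intModel_of_rowCheck
    (Literature.NumberTheory.EllipticCurves.integralModelInt_baseChange_int (⟨1, -1, 0, -11, -12⟩ : WeierstrassCurve ℤ))
    tamRowCheck_n4771 2 (by decide)

/-- **`∏ c_ℓ` is odd** (the door's `htam` binder). [cite: Silverman1994, IV.9.4 Step 2] -/
theorem odd_tamagawaProduct_n4771 [((⟨1, -1, 0, -11, -12⟩ : WeierstrassCurve ℤ).baseChange ℚ).IsGloballyMinimal] :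
    Odd ((⟨1, -1, 0, -11, -12⟩ : WeierstrassCurve ℤ).baseChange ℚ).tamagawaProduct :=
  Nat.odd_iff.mpr (Nat.two_dvd_ne_zero.mp not_two_dvd_tamagawaProduct_n4771)

/-- **`[1, -1, 0, -11, -12]` has no complex multiplication**: `j = 537³/(-4771)` is not an integer. [cite: SilvermanAEC2009, App. C §11] -/
theorem not_hasCM_n4771 [((⟨1, -1, 0, -11, -12⟩ : WeierstrassCurve ℤ).baseChange ℚ).IsElliptic] :
    ¬ ((⟨1, -1, 0, -11, -12⟩ : WeierstrassCurve ℤ).baseChange ℚ).HasCM := fun hCM ↦ by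
  obtain ⟨n, hn⟩ := ((⟨1, -1, 0, -11, -12⟩ : WeierstrassCurve ℤ).baseChange ℚ).exists_intCast_eq_j_of_hasCM hCM
  rw [j_eq_c₄_pow_div, baseChange_int_c₄, baseChange_int_Δ, M4771_c₄, M4771_Δ] at hn
  have h : (n : ℚ) * (-4771) = (537) ^ 3 := by
    rw [hn]; push_cast; field_simp
  have h' : n * (-4771) = (537) ^ 3 := by exact_mod_cast h
  omega

/-! ## §2 `BSD₂` from Creutz–Miller 2012 Thm. 1.1 (`N = 4771 < 5000`, rank `= r_an = 0`) -/

/-- **`BSD([1, -1, 0, -11, -12], 2)`** modulo PRINT {Creutz–Miller 2012 Thm. 1.1 (`hCM`), GZK (`hGZK`)} + the certificate `r_an(n4771) = 0`.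
[cite: CreutzMiller2012, Thm. 1.1] [cite: Miller2011LMS, Def. 1.1] -/
theorem bsdp_two_n4771_of_creutzMiller [((⟨1, -1, 0, -11, -12⟩ : WeierstrassCurve ℤ).baseChange ℚ).IsElliptic]
    [((⟨1, -1, 0, -11, -12⟩ : WeierstrassCurve ℤ).baseChange ℚ).IsGloballyMinimal]
    (hCM : bsdTriple_of_rank_le_one_of_conductor_lt) (hGZK : rank_eq_analyticRank_of_analyticRank_le_one)
    (hr : ((⟨1, -1, 0, -11, -12⟩ : WeierstrassCurve ℤ).baseChange ℚ).analyticRank = 0) :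
    BSDp ((⟨1, -1, 0, -11, -12⟩ : WeierstrassCurve ℤ).baseChange ℚ) 2 :=
  forall_bsdp_of_bsdTriple _ (tamagawaProduct_pos_holds _)
    (hCM _ (by rw [(hGZK _ (by omega)).1]; omega) (by rw [conductorNorm_n4771]; norm_num)) 2 Nat.prime_two

/-! ## §3 The unit certificate of `ℚ(β)`: `η = (29464 + 1199u - 181u²)/8`, `u = 4β` -/

/-- **The cubic unit equation in `ℚ(β)`**: with `P = 29464 + 1199 * X - 181 * X ^ 2`, `k = 3`, `m = 1`, the element `η = P(4β)/8` satisfies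
`η³ − 3331η² + 2989899η − 1 = 0` (so `η ∈ (𝓞ℚ(β))ˣ`, norm `+1`) — one `linear_combination` against `ψ_W(β) = 4β³ − 3β² − 44β − 48 = 0`
with the multiplier emitted by `rowkit.py` (coefficients `-11859482, 50026047, 498699707/8, -328885378` on `β³, β², β, 1`). [cite: SilvermanAEC2009, III.1] [cite: Lang1990, Ch. 13 §4] -/
theorem unit_eq_n4771 {β : AlgebraicClosure ℚ}
    (hβ : aeval β ((⟨1, -1, 0, -11, -12⟩ : WeierstrassCurve ℤ).baseChange ℚ).twoTorsionPolynomial.toPoly = 0) :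
    (aeval (4 * (AdjoinSimple.gen ℚ β : ↥(IntermediateField.adjoin ℚ ({β} : Set (AlgebraicClosure ℚ)))))
          (((29464 + 1199 * X - 181 * X ^ 2 : ℤ[X])).map (Int.castRingHom ℚ)) /
          (2 ^ (3 : ℕ) * ((1 : ℤ) : ↥(IntermediateField.adjoin ℚ ({β} : Set (AlgebraicClosure ℚ)))))) ^ 3
        - ((3331 : ℤ) : ↥(IntermediateField.adjoin ℚ ({β} : Set (AlgebraicClosure ℚ)))) *
          (aeval (4 * (AdjoinSimple.gen ℚ β : ↥(IntermediateField.adjoin ℚ ({β} : Set (AlgebraicClosure ℚ)))))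
          (((29464 + 1199 * X - 181 * X ^ 2 : ℤ[X])).map (Int.castRingHom ℚ)) /
          (2 ^ (3 : ℕ) * ((1 : ℤ) : ↥(IntermediateField.adjoin ℚ ({β} : Set (AlgebraicClosure ℚ)))))) ^ 2
        + ((2989899 : ℤ) : ↥(IntermediateField.adjoin ℚ ({β} : Set (AlgebraicClosure ℚ)))) *
          (aeval (4 * (AdjoinSimple.gen ℚ β : ↥(IntermediateField.adjoin ℚ ({β} : Set (AlgebraicClosure ℚ)))))
          (((29464 + 1199 * X - 181 * X ^ 2 : ℤ[X])).map (Int.castRingHom ℚ)) /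
          (2 ^ (3 : ℕ) * ((1 : ℤ) : ↥(IntermediateField.adjoin ℚ ({β} : Set (AlgebraicClosure ℚ))))))
        - ((1 : ℤ) : ↥(IntermediateField.adjoin ℚ ({β} : Set (AlgebraicClosure ℚ)))) = 0 := by
  have hψ := psi_gen_eq_zero ((⟨1, -1, 0, -11, -12⟩ : WeierstrassCurve ℤ).baseChange ℚ) hβ
  rw [c4771_b.1, c4771_b.2.1, c4771_b.2.2] at hψ
  set g : ↥(IntermediateField.adjoin ℚ ({β} : Set (AlgebraicClosure ℚ))) := AdjoinSimple.gen ℚ β with hg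
  simp only [Polynomial.map_add, Polynomial.map_sub, Polynomial.map_pow, Polynomial.map_mul, Polynomial.map_X,
    Polynomial.map_ofNat, map_add, map_sub, map_pow, map_mul, aeval_X, map_ofNat] at hψ ⊢
  push_cast at hψ ⊢
  linear_combination (-(11859482 : ↥(IntermediateField.adjoin ℚ ({β} : Set (AlgebraicClosure ℚ)))) * g ^ 3
    + (50026047 : ↥(IntermediateField.adjoin ℚ ({β} : Set (AlgebraicClosure ℚ)))) * g ^ 2
    + (498699707 / 8 : ↥(IntermediateField.adjoin ℚ ({β} : Set (AlgebraicClosure ℚ)))) * g - 328885378) * hψ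

/-- `2^6 ∣ c_W(19)` for the `u`-cubic `c_W = u³ − 3u² − 176u − 768` (`c_W(19) = 1664`): `e ≡ 19 (mod 2^6)`-compatible certificate for the odd `2`-adic root `e`.
[cite: Serre1973, Ch. II §2.2] -/
theorem cubic_dvd_n4771 [((⟨1, -1, 0, -11, -12⟩ : WeierstrassCurve ℤ).baseChange ℚ).IsGloballyMinimal] :
    (2 : ℤ) ^ (3 + 3) ∣ (19 : ℤ) ^ 3
      + (integralModelInt ((⟨1, -1, 0, -11, -12⟩ : WeierstrassCurve ℤ).baseChange ℚ)).b₂ * 19 ^ 2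
      + 8 * (integralModelInt ((⟨1, -1, 0, -11, -12⟩ : WeierstrassCurve ℤ).baseChange ℚ)).b₄ * 19
      + 16 * (integralModelInt ((⟨1, -1, 0, -11, -12⟩ : WeierstrassCurve ℤ).baseChange ℚ)).b₆ := by
  rw [Literature.NumberTheory.EllipticCurves.integralModelInt_baseChange_int]
  decide

/-- The sign congruence `P(19)·1 = -13096 ≡ 2^3·3 (mod 2^6)` (`σ(η) ≡ 3 (mod 8)`: the Hilbert symbol `(σ(η), 2)₂ = −1`). [cite: Serre1973, Ch. III §1.2 Thm. 1] -/
theorem signCert_n4771 :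
    ((((29464 + 1199 * X - 181 * X ^ 2 : ℤ[X])).eval 19 * 1 : ℤ) : ZMod (2 ^ (3 + 3))) = ((2 ^ 3 * 3 : ℤ) : ZMod (2 ^ (3 + 3))) := by
  simp only [eval_add, eval_sub, eval_pow, eval_mul, eval_ofNat, eval_X]
  decide

/-! ## §4 THE ROW: `MC₂([1, -1, 0, -11, -12])` from PRINT + Creutz–Miller + `hYY` + MuIneqʳ + `r_an = 0` + one `L`-value bit -/

/-- **ODD-BRANCH ROW — `MazurMainConjecture [1, -1, 0, -11, -12] 2` (conductor `4771 = 13·367`).** Displayed: PRINT⁵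
{`h17` Kato 17.4 (1)(2) at `2`, `hGr` Greenberg 4.1, `hper` period unit, `hmod` modularity, `hGZK`} + `hCM` Creutz–Miller 2012 (gives `BSD₂`, `N < 5000`) +
`hYY` (Brumer–Kramer / Yoo–Yu) + `hI` = MuIneqʳ (the registered stub of line `birth`, VERBATIM) + the certificate `r_an = 0` + ONE datum «`L(E,1)/Ω = q` with
`q ≠ 0`, `ord₂ q = 0`» (computed on the seat: `w = +1`, `L(1) = Ω = 1.3028627973`, `q = 1`; torsion trivial, all `c_p = 1`). Every other binder of
att-p5 g30's door `…CubicChevalleyLValueBit.mazurMainConjecture_two_of_muIneqRel_of_lValue_unit_of_unitCerts_muFree` — ellipticity, minimality, good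
ordinary reduction at `2`, no rational `2`-torsion abscissa, `Δ < 0`, off the Kilford stratum, `∏ c_v` odd (Tate row certificate), a root `β ∈ ℚ̄` of
the `2`-division cubic, the unit `η = P(4β)/8` with its cubic equation (`T = 3331`, `S = 2989899`, `sgn = +1`) and the `2`-adic certificate
(`a = 19`, `c = 3`, `2^6 ∣ c_W(19)`, `P(19) ≡ 24 (mod 2^6)`) — is decided by the kernel. CONDITIONAL; BSD is NOT proved; nothing closed.
[cite: CreutzMiller2012, Thm. 1.1] [cite: YooYu2022, Thm. 1.6 with Thm. 1.10 and 1.11] [cite: Kato2004Asterisque, Thm. 17.4 (1)(2) (p. 273)]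
[cite: GreenbergLNM1716, Thm. 4.1 (p. 102)] [cite: Miller2011LMS, Def. 1.1] [cite: Fukuda1994, Thm. 1 (1), p. 264] [cite: Lang1990, Ch. 13 §4, Lemma 4.1]
[cite: Serre1973, Ch. III §1.2 Thm. 1] -/
theorem mazurMainConjecture_two_n4771_of_lValue
    [((⟨1, -1, 0, -11, -12⟩ : WeierstrassCurve ℤ).baseChange ℚ).IsElliptic] [((⟨1, -1, 0, -11, -12⟩ : WeierstrassCurve ℤ).baseChange ℚ).IsGloballyMinimal]
    (h17 : ∀ [NeZero (((⟨1, -1, 0, -11, -12⟩ : WeierstrassCurve ℤ).baseChange ℚ).conductorNorm ℤ)]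
      (f : CuspForm (Gamma0 (((⟨1, -1, 0, -11, -12⟩ : WeierstrassCurve ℤ).baseChange ℚ).conductorNorm ℤ)) 2),
      kato_divisibility_allPrimes ((⟨1, -1, 0, -11, -12⟩ : WeierstrassCurve ℤ).baseChange ℚ) 2 (f := f))
    (hGr : Greenberg1999.thm41_charValue_rankZero_anyPrime)
    (hper : realPeriodRat_eq_unit_mul_plusPeriod_two) (hmod : nonempty_modularParametrizationData)
    (hGZK : rank_eq_analyticRank_of_analyticRank_le_one)
    (hCM : bsdTriple_of_rank_le_one_of_conductor_lt)
    (hYY : yooYu_selmerTwo_eq_bot_oddClassNumber_cubicTwoTorsionField)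
    (hI : ∀ (W : WeierstrassCurve ℚ) [W.IsElliptic] [W.IsGloballyMinimal], IsOrdinaryAt W 2 →
      (∀ x : ℚ, ¬ HasRationalTwoTorsionX W x) →
      ∀ (κ : ZpExtension ℚ 2) (γ : Field.absoluteGaloisGroup ℚ), κ.IsCyclotomic →
      κ.IsTopGenerator γ → IsCyclotomicVariable 2 γ →
      ∀ ⦃N : ℕ⦄ [NeZero N] (f : CuspForm (Gamma0 N) 2), IsNewformOf W f →
      ∀ Gp : IwasawaAlgebra 2, iwasawaToPowerSeries 2 Gp = padicLFunction f (unitRoot W 2 : ℚ_[2]) →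
      ∀ (D : W.SelmerDualData κ γ) (Yr : W.FineSelmerDualDataRelaxedInf κ γ),
        lengthAt (IwasawaAlgebra 2) D.X ⟨IwasawaAlgebra.augIdealP 2, IwasawaAlgebra.isPrime_augIdealP_holds 2⟩ ≤
          lengthAt (IwasawaAlgebra 2) (IwasawaAlgebra 2 ⧸ Ideal.span {Gp})
              ⟨IwasawaAlgebra.augIdealP 2, IwasawaAlgebra.isPrime_augIdealP_holds 2⟩ +
            lengthAt (IwasawaAlgebra 2) Yr.X ⟨IwasawaAlgebra.augIdealP 2, IwasawaAlgebra.isPrime_augIdealP_holds 2⟩)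
    (hr : ((⟨1, -1, 0, -11, -12⟩ : WeierstrassCurve ℤ).baseChange ℚ).analyticRank = 0)
    {q : ℚ} (hq0 : q ≠ 0) (hq : padicValRat 2 q = 0)
    (hL : ((⟨1, -1, 0, -11, -12⟩ : WeierstrassCurve ℤ).baseChange ℚ).entireLFunction 1 /
      ((((⟨1, -1, 0, -11, -12⟩ : WeierstrassCurve ℤ).baseChange ℚ).realPeriodRat : ℂ)) = (q : ℂ)) :
    MazurMainConjecture ((⟨1, -1, 0, -11, -12⟩ : WeierstrassCurve ℤ).baseChange ℚ) 2 := by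
  -- a root `β ∈ ℚ̄` of the `2`-division cubic `4x³ − 3x² − 44x − 48`
  have hdeg : ((⟨1, -1, 0, -11, -12⟩ : WeierstrassCurve ℤ).baseChange ℚ).twoTorsionPolynomial.toPoly.degree ≠ 0 := by
    rw [Cubic.degree_of_a_ne_zero (by simp [WeierstrassCurve.twoTorsionPolynomial])]; decide
  obtain ⟨β, hβ⟩ := IsAlgClosed.exists_aeval_eq_zero (AlgebraicClosure ℚ) _ hdeg
  have hord : IsOrdinaryAt ((⟨1, -1, 0, -11, -12⟩ : WeierstrassCurve ℤ).baseChange ℚ) 2 := goodOrd_two_n4771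
  exact mazurMainConjecture_two_of_muIneqRel_of_lValue_unit_of_unitCerts_muFree _ h17 hGr hper hmod hGZK hYY hI hord
    not_hasRationalTwoTorsionX_n4771 Δ_n4771_neg hr (bsdp_two_n4771_of_creutzMiller hCM hGZK hr) not_onKilfordStratumAtTwo_n4771
    odd_tamagawaProduct_n4771 ⟨q, hq0, hL, hq⟩ hβ (29464 + 1199 * X - 181 * X ^ 2) 3 1 1 19 3 (3331) 2989899 (1) (Or.inl rfl) (unit_eq_n4771 hβ)
    (Or.inl rfl) ⟨9, by norm_num⟩ cubic_dvd_n4771 (by decide) signCert_n4771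

/-- **THE ROW WITH THE VALUE `L(E,1)/Ω = 1`** (numerically `w = +1`, `L(1) = Ω = 1.3028627973` for `[1, -1, 0, -11, -12]`; torsion trivial, all `c_p = 1`,
so BSD predicts `L/Ω = #Ш`). [cite: CreutzMiller2012, Thm. 1.1] [cite: YooYu2022, Thm. 1.6 with Thm. 1.10 and 1.11] [cite: Kato2004Asterisque, Thm. 17.4 (1)(2) (p. 273)]
[cite: GreenbergLNM1716, Thm. 4.1 (p. 102)] [cite: Miller2011LMS, Def. 1.1] -/
theorem mazurMainConjecture_two_n4771_of_lValue_eq_one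
    [((⟨1, -1, 0, -11, -12⟩ : WeierstrassCurve ℤ).baseChange ℚ).IsElliptic] [((⟨1, -1, 0, -11, -12⟩ : WeierstrassCurve ℤ).baseChange ℚ).IsGloballyMinimal]
    (h17 : ∀ [NeZero (((⟨1, -1, 0, -11, -12⟩ : WeierstrassCurve ℤ).baseChange ℚ).conductorNorm ℤ)]
      (f : CuspForm (Gamma0 (((⟨1, -1, 0, -11, -12⟩ : WeierstrassCurve ℤ).baseChange ℚ).conductorNorm ℤ)) 2),
      kato_divisibility_allPrimes ((⟨1, -1, 0, -11, -12⟩ : WeierstrassCurve ℤ).baseChange ℚ) 2 (f := f))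
    (hGr : Greenberg1999.thm41_charValue_rankZero_anyPrime)
    (hper : realPeriodRat_eq_unit_mul_plusPeriod_two) (hmod : nonempty_modularParametrizationData)
    (hGZK : rank_eq_analyticRank_of_analyticRank_le_one)
    (hCM : bsdTriple_of_rank_le_one_of_conductor_lt)
    (hYY : yooYu_selmerTwo_eq_bot_oddClassNumber_cubicTwoTorsionField)
    (hI : ∀ (W : WeierstrassCurve ℚ) [W.IsElliptic] [W.IsGloballyMinimal], IsOrdinaryAt W 2 →
      (∀ x : ℚ, ¬ HasRationalTwoTorsionX W x) →
      ∀ (κ : ZpExtension ℚ 2) (γ : Field.absoluteGaloisGroup ℚ), κ.IsCyclotomic →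
      κ.IsTopGenerator γ → IsCyclotomicVariable 2 γ →
      ∀ ⦃N : ℕ⦄ [NeZero N] (f : CuspForm (Gamma0 N) 2), IsNewformOf W f →
      ∀ Gp : IwasawaAlgebra 2, iwasawaToPowerSeries 2 Gp = padicLFunction f (unitRoot W 2 : ℚ_[2]) →
      ∀ (D : W.SelmerDualData κ γ) (Yr : W.FineSelmerDualDataRelaxedInf κ γ),
        lengthAt (IwasawaAlgebra 2) D.X ⟨IwasawaAlgebra.augIdealP 2, IwasawaAlgebra.isPrime_augIdealP_holds 2⟩ ≤
          lengthAt (IwasawaAlgebra 2) (IwasawaAlgebra 2 ⧸ Ideal.span {Gp})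
              ⟨IwasawaAlgebra.augIdealP 2, IwasawaAlgebra.isPrime_augIdealP_holds 2⟩ +
            lengthAt (IwasawaAlgebra 2) Yr.X ⟨IwasawaAlgebra.augIdealP 2, IwasawaAlgebra.isPrime_augIdealP_holds 2⟩)
    (hr : ((⟨1, -1, 0, -11, -12⟩ : WeierstrassCurve ℤ).baseChange ℚ).analyticRank = 0)
    (hL1 : ((⟨1, -1, 0, -11, -12⟩ : WeierstrassCurve ℤ).baseChange ℚ).entireLFunction 1 /
      ((((⟨1, -1, 0, -11, -12⟩ : WeierstrassCurve ℤ).baseChange ℚ).realPeriodRat : ℂ)) = ((1 : ℚ) : ℂ)) :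
    MazurMainConjecture ((⟨1, -1, 0, -11, -12⟩ : WeierstrassCurve ℤ).baseChange ℚ) 2 :=
  mazurMainConjecture_two_n4771_of_lValue h17 hGr hper hmod hGZK hCM hYY hI hr one_ne_zero (by simp) hL1

/-- **`μ₂ = 0` for the cyclotomic `ℤ₂`-extension of the cubic `2`-torsion field `ℚ(β)` of `[1, -1, 0, -11, -12]`** (`β` any root of
`4x³ − 3x² − 44x − 48` in `ℚ̄`; the cubic field of discriminant `-4771`), modulo `hYY` + Creutz–Miller + GZK + `r_an = 0` + the datum «`L(E,1)/Ω = q`, `q ≠ 0`, `ord₂ q = 0`»: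
att-p5 g30's `classicalMuVanishes_adjoin_of_lValue_unit_of_unitCerts_of_not_onKilfordStratumAtTwo` with every other binder kernel-decided.
[cite: YooYu2022, Thm. 1.6 with Thm. 1.10 and 1.11] [cite: CreutzMiller2012, Thm. 1.1] [cite: Fukuda1994, Thm. 1 (1), p. 264]
[cite: Lang1990, Ch. 13 §4, Lemma 4.1] [cite: Serre1973, Ch. III §1.2 Thm. 1] -/
theorem classicalMuVanishes_cubicField_n4771_of_lValue
    (hYY : yooYu_selmerTwo_eq_bot_oddClassNumber_cubicTwoTorsionField)
    [((⟨1, -1, 0, -11, -12⟩ : WeierstrassCurve ℤ).baseChange ℚ).IsElliptic] [((⟨1, -1, 0, -11, -12⟩ : WeierstrassCurve ℤ).baseChange ℚ).IsGloballyMinimal]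
    (hCM : bsdTriple_of_rank_le_one_of_conductor_lt) (hGZK : rank_eq_analyticRank_of_analyticRank_le_one)
    (hr : ((⟨1, -1, 0, -11, -12⟩ : WeierstrassCurve ℤ).baseChange ℚ).analyticRank = 0)
    {q : ℚ} (hq0 : q ≠ 0) (hq : padicValRat 2 q = 0)
    (hL : ((⟨1, -1, 0, -11, -12⟩ : WeierstrassCurve ℤ).baseChange ℚ).entireLFunction 1 /
      ((((⟨1, -1, 0, -11, -12⟩ : WeierstrassCurve ℤ).baseChange ℚ).realPeriodRat : ℂ)) = (q : ℂ))
    {β : AlgebraicClosure ℚ}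
    (hβ : aeval β ((⟨1, -1, 0, -11, -12⟩ : WeierstrassCurve ℤ).baseChange ℚ).twoTorsionPolynomial.toPoly = 0)
    (κP : ZpExtension ↥(IntermediateField.adjoin ℚ ({β} : Set (AlgebraicClosure ℚ))) 2) (hκP : κP.IsCyclotomic) :
    ClassicalMuVanishes κP := by
  have hord : IsOrdinaryAt ((⟨1, -1, 0, -11, -12⟩ : WeierstrassCurve ℤ).baseChange ℚ) 2 := goodOrd_two_n4771
  exact classicalMuVanishes_adjoin_of_lValue_unit_of_unitCerts_of_not_onKilfordStratumAtTwo _ hYY hord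
    not_hasRationalTwoTorsionX_n4771 Δ_n4771_neg not_onKilfordStratumAtTwo_n4771 odd_tamagawaProduct_n4771 hr
    (bsdp_two_n4771_of_creutzMiller hCM hGZK hr) ⟨q, hq0, hL, hq⟩ hβ (29464 + 1199 * X - 181 * X ^ 2) 3 1 1 19 3 (3331) 2989899 (1) (Or.inl rfl)
    (unit_eq_n4771 hβ) (Or.inl rfl) ⟨9, by norm_num⟩ cubic_dvd_n4771 (by decide) signCert_n4771 κP hκP

end Summit.BirchSwinnertonDyer.BirchSwinnertonDyer.Theorems.AlignedTransportAtTwoCubicChevalleyRowN4771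

end
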